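import Mathlib
import HarnessLib
import Literature.Computability.AlgebraicComplexity.VSBRProductDepth
import Summits.ValiantsHypothesis.ValiantsHypothesis.Theses.DefinabilityGap
import Summits.ValiantsHypothesis.ValiantsHypothesis.Theorems.DefinabilityGapAffineRung
import Summits.ValiantsHypothesis.ValiantsHypothesis.Theorems.DepthWindowBinarisation

/-!
# DefinabilityGap — the depth ladder of `K1 = KIPlantedHitting`: top and saturation
# (support for item `stmt-ValiantsHypothesis-23547`; decomp-valiant lens 5, generation 13)

Companion of `DefinabilityGapK1DepthLadder` (the transfer and the growing rung).  `K1pd(δ)` denotes `K1` restricted to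
annihilators computed by unbounded-fan-in circuits of product-depth `≤ δ m` with `≤ q(m)^b` wires and degree `≤ q^b`
(spelled out; no `Prop` definitions vendored).  Kernel, unconditional:

§1 TOP.  `K1 ⟺ K1wires` (`k1Wires_of_kiPlantedHitting`, `kiPlantedHitting_of_k1Wires`): binarisation
   `complexity ≤ 2 · wires` (`DepthWindow.complexity_eval_le_two_mul_edgeSize`) one way, `wires ≤ 2 · gates` for
   fan-in two (`edgeSize_le_two_mul_size_holds`) the other.  Hence `K1 ⟹ K1pd(δ)` for EVERY depth function `δ`
   (`k1AtDepth_of_k1Wires`) — the S-certificate (`S → K1 → K1pd(δ)`) of every rung, in particular of g12's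
   constant-depth rung `K1cd` (noted in `DefinabilityGapK1ConstDepthRung` as not landed) — and the ladder is monotone
   in `δ` (`k1AtDepth_mono`).
§2 SATURATION (`kiPlantedHitting_of_k1Log`, `k1Log_of_kiPlantedHitting`): by the in-tree Valiant–Skyum–Berkowitz–
   Rackoff theorem in product-depth form (`DepthReduction.exists_computes_productDepth_le_clog`), `K1` is equivalent
   to `K1` at product-depth `⌈log₂ q(m)^b⌉ = O(b log m)` with `≤ q^b` wires: the depth ladder has finite height, and
   the open climb runs from `⌊0.72 log₂log₂log₂ m⌋` (companion file) to `O(log m)` — lens 4's depth window in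
   hitting-set currency.

References: [KabanetsImpagliazzo2003] Thm. 7.7; [ValiantSkyumBerkowitzRackoff1983]; [Burgisser2000TCS] §2, Thm. 2.5;
[Burgisser2000] Def. 2.1.
-/

set_option linter.dupNamespace false

noncomputable section

open MvPolynomial
open Literature.Computability.AlgebraicComplexity Literature.Computability.MetaComplexity
open Summit.ValiantsHypothesis.ValiantsHypothesis.Theorems.DefinabilityGapAffineRung (qOf qOf_spec sq_le_qOf kiPer)
open Summit.ValiantsHypothesis.ValiantsHypothesis.Theorems.DepthWindow (complexity_eval_le_two_mul_edgeSize)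
open Summit.ValiantsHypothesis.ValiantsHypothesis.Theses.DefinabilityGap (KIPlantedHitting)

namespace Summit.ValiantsHypothesis.ValiantsHypothesis.Theorems.DefinabilityGapK1DepthLadderTop

/-! ## §1 The top of the ladder: `K1 ⟺ K1wires`, which implies every depth rung -/

/-- **`K1 ⟹ K1wires`** (S-certificate of the whole ladder): if the KI-planted permanent map hits every nonzero `D` of
fan-in-two complexity and degree `≤ q^b` (all `b`, infinitely often), then it hits every nonzero `D` of degree
`≤ q^b` computed by an unbounded-fan-in circuit with `≤ q^b` WIRES — of any product-depth — since such a circuit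
binarises to fan-in-two complexity `≤ 2 · wires ≤ q^{b+1}` (`complexity_eval_le_two_mul_edgeSize`).
[cite: KabanetsImpagliazzo2003, Thm. 7.7] [cite: Burgisser2000TCS, §2] -/
theorem k1Wires_of_kiPlantedHitting (hK1 : KIPlantedHitting) :
    ∀ b m₀ : ℕ, ∃ m, m₀ ≤ m ∧
      ∀ (Γ : ArithCircuit ℂ (Fin 3 → Fin (qOf m))) (D : MvPolynomial (Fin 3 → Fin (qOf m)) ℂ),
        Γ.Computes D → Γ.edgeSize ≤ qOf m ^ b → D ≠ 0 → D.totalDegree ≤ qOf m ^ b → bind₁ (kiPer m) D ≠ 0 := by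
  intro b m₀
  obtain ⟨m, hm, hhit⟩ := hK1 (b + 1) m₀
  refine ⟨m, hm, fun Γ D hC hCe hD hdeg => ?_⟩
  have hq2 : 2 ≤ qOf m := (qOf_spec m).2.two_le
  have hcx : complexity D ≤ qOf m ^ (b + 1) := by
    have h := complexity_eval_le_two_mul_edgeSize Γ
    rw [show Γ.eval = D from hC] at h
    calc complexity D ≤ 2 * Γ.edgeSize := h
      _ ≤ 2 * qOf m ^ b := Nat.mul_le_mul_left _ hCe
      _ ≤ qOf m * qOf m ^ b := Nat.mul_le_mul_right _ hq2
      _ = qOf m ^ (b + 1) := by ring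
  have hdeg' : D.totalDegree ≤ qOf m ^ (b + 1) := hdeg.trans (Nat.pow_le_pow_right (by omega) (by omega))
  exact hhit D hD hcx hdeg'

/-- **`K1wires ⟹ K1`** (the converse: a fan-in-two circuit of size `s` has `≤ 2s` wires,
`edgeSize_le_two_mul_size_holds`), so the wires form IS `K1` and the depth ladder below has `K1` itself as its top.
[cite: KabanetsImpagliazzo2003, Thm. 7.7] [cite: Burgisser2000, Def. 2.1] -/
theorem kiPlantedHitting_of_k1Wires
    (h : ∀ b m₀ : ℕ, ∃ m, m₀ ≤ m ∧
      ∀ (Γ : ArithCircuit ℂ (Fin 3 → Fin (qOf m))) (D : MvPolynomial (Fin 3 → Fin (qOf m)) ℂ),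
        Γ.Computes D → Γ.edgeSize ≤ qOf m ^ b → D ≠ 0 → D.totalDegree ≤ qOf m ^ b → bind₁ (kiPer m) D ≠ 0) :
    KIPlantedHitting := by
  intro b m₀
  obtain ⟨m, hm, hhit⟩ := h (b + 1) m₀
  refine ⟨m, hm, fun D hD hcx hdeg => ?_⟩
  have hq2 : 2 ≤ qOf m := (qOf_spec m).2.two_le
  obtain ⟨P, hP2, hPc, hPs⟩ := ArithCircuit.exists_computes_size_eq_complexity D
  have hPe : P.edgeSize ≤ qOf m ^ (b + 1) :=
    calc P.edgeSize ≤ 2 * P.size := ArithCircuit.edgeSize_le_two_mul_size_holds hP2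
      _ ≤ 2 * qOf m ^ b := by rw [hPs]; exact Nat.mul_le_mul_left _ hcx
      _ ≤ qOf m * qOf m ^ b := Nat.mul_le_mul_right _ hq2
      _ = qOf m ^ (b + 1) := by ring
  have hdeg' : D.totalDegree ≤ qOf m ^ b := hdeg
  exact hhit P D hPc hPe hD (hdeg'.trans (Nat.pow_le_pow_right (by omega) (Nat.le_succ b)))

/-- **Every depth rung is below the top**: `K1wires ⟹ K1` at product-depth `δ`, for every depth function `δ`
(drop the depth hypothesis); with `k1Wires_of_kiPlantedHitting` this is the S-certificate `K1 ⟹ K1pd(δ)` of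
each rung, in particular of g12's constant-depth rung `K1cd` (there noted as not landed). [cite: KabanetsImpagliazzo2003, Thm. 7.7] -/
theorem k1AtDepth_of_k1Wires
    (h : ∀ b m₀ : ℕ, ∃ m, m₀ ≤ m ∧
      ∀ (Γ : ArithCircuit ℂ (Fin 3 → Fin (qOf m))) (D : MvPolynomial (Fin 3 → Fin (qOf m)) ℂ),
        Γ.Computes D → Γ.edgeSize ≤ qOf m ^ b → D ≠ 0 → D.totalDegree ≤ qOf m ^ b → bind₁ (kiPer m) D ≠ 0)
    (δ : ℕ → ℕ) :
    ∀ b m₀ : ℕ, ∃ m, m₀ ≤ m ∧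
      ∀ (Γ : ArithCircuit ℂ (Fin 3 → Fin (qOf m))) (D : MvPolynomial (Fin 3 → Fin (qOf m)) ℂ),
        Γ.Computes D → Γ.productDepth ≤ δ m → Γ.edgeSize ≤ qOf m ^ b → D ≠ 0 → D.totalDegree ≤ qOf m ^ b →
        bind₁ (kiPer m) D ≠ 0 := fun b m₀ => by
  obtain ⟨m, hm, hhit⟩ := h b m₀
  exact ⟨m, hm, fun Γ D hC _ hCe hD hdeg => hhit Γ D hC hCe hD hdeg⟩

/-- **The ladder is monotone in the depth function**: `K1pd(δ₂) ⟹ K1pd(δ₁)` whenever `δ₁ ≤ δ₂` pointwise. [folklore] -/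
theorem k1AtDepth_mono {δ₁ δ₂ : ℕ → ℕ} (hle : ∀ m, δ₁ m ≤ δ₂ m)
    (h : ∀ b m₀ : ℕ, ∃ m, m₀ ≤ m ∧
      ∀ (Γ : ArithCircuit ℂ (Fin 3 → Fin (qOf m))) (D : MvPolynomial (Fin 3 → Fin (qOf m)) ℂ),
        Γ.Computes D → Γ.productDepth ≤ δ₂ m → Γ.edgeSize ≤ qOf m ^ b → D ≠ 0 → D.totalDegree ≤ qOf m ^ b →
        bind₁ (kiPer m) D ≠ 0) :
    ∀ b m₀ : ℕ, ∃ m, m₀ ≤ m ∧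
      ∀ (Γ : ArithCircuit ℂ (Fin 3 → Fin (qOf m))) (D : MvPolynomial (Fin 3 → Fin (qOf m)) ℂ),
        Γ.Computes D → Γ.productDepth ≤ δ₁ m → Γ.edgeSize ≤ qOf m ^ b → D ≠ 0 → D.totalDegree ≤ qOf m ^ b →
        bind₁ (kiPer m) D ≠ 0 := fun b m₀ => by
  obtain ⟨m, hm, hhit⟩ := h b m₀
  exact ⟨m, hm, fun Γ D hC hd hCe hD hdeg => hhit Γ D hC (hd.trans (hle m)) hCe hD hdeg⟩

/-! ## §2 The ladder saturates at logarithmic product-depth (Valiant–Skyum–Berkowitz–Rackoff) -/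

/-- `vsbrEdgeBound (q³) (q^b) L ≤ q^{13 b + 25}` for `L ≤ q^b` (`q = q(m) ≥ 2`). [folklore] -/
theorem vsbrEdgeBound_le_qOf_pow (m b : ℕ) {L : ℕ} (hL : L ≤ qOf m ^ b) :
    DepthReduction.vsbrEdgeBound (qOf m ^ 3) (qOf m ^ b) L ≤ qOf m ^ (13 * b + 25) := by
  have hq2 : 2 ≤ qOf m := (qOf_spec m).2.two_le
  have hB : 1 ≤ qOf m ^ b := Nat.one_le_pow _ _ (by omega)
  have hq3 : 1 ≤ qOf m ^ 3 := Nat.one_le_pow _ _ (by omega)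
  unfold DepthReduction.vsbrEdgeBound
  have h1 : 4 * L * (qOf m ^ b + 1) ^ 2 + 1 ≤ 17 * (qOf m ^ b) ^ 3 := by
    have hsq : (qOf m ^ b + 1) ^ 2 ≤ (2 * qOf m ^ b) ^ 2 := Nat.pow_le_pow_left (by omega) 2
    have hB3 : 1 ≤ (qOf m ^ b) ^ 3 := Nat.one_le_pow _ _ hB
    calc 4 * L * (qOf m ^ b + 1) ^ 2 + 1 ≤ 4 * qOf m ^ b * (2 * qOf m ^ b) ^ 2 + 1 :=
          Nat.add_le_add_right (Nat.mul_le_mul (Nat.mul_le_mul_left _ hL) hsq) _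
      _ = 16 * (qOf m ^ b) ^ 3 + 1 := by ring
      _ ≤ 17 * (qOf m ^ b) ^ 3 := by omega
  have h2 : (4 * L * (qOf m ^ b + 1) ^ 2 + 1) ^ 4 ≤ 83521 * (qOf m ^ b) ^ 12 := by
    calc (4 * L * (qOf m ^ b + 1) ^ 2 + 1) ^ 4 ≤ (17 * (qOf m ^ b) ^ 3) ^ 4 := Nat.pow_le_pow_left h1 4
      _ = 83521 * (qOf m ^ b) ^ 12 := by ring
  have hconst : 3006756 ≤ qOf m ^ 22 :=
    calc (3006756 : ℕ) ≤ 2 ^ 22 := by norm_num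
      _ ≤ qOf m ^ 22 := Nat.pow_le_pow_left hq2 22
  calc 9 * (4 * L * (qOf m ^ b + 1) ^ 2 + 1) ^ 4 * (qOf m ^ 3 + 1) * (qOf m ^ b + 1)
      ≤ 9 * (83521 * (qOf m ^ b) ^ 12) * (2 * qOf m ^ 3) * (2 * qOf m ^ b) := by
        gcongr
        · omega
        · omega
    _ = 3006756 * ((qOf m ^ b) ^ 13 * qOf m ^ 3) := by ring
    _ ≤ qOf m ^ 22 * ((qOf m ^ b) ^ 13 * qOf m ^ 3) := Nat.mul_le_mul_right _ hconst
    _ = qOf m ^ (13 * b + 25) := by rw [← pow_mul, ← pow_add, ← pow_add]; ring_nf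

/-- **The top of the ladder sits at logarithmic product-depth: `K1log ⟹ K1`** (kernel, from the in-tree VSBR theorem
`DepthReduction.exists_computes_productDepth_le_clog`): if `G_m` hits (all `b`, infinitely often) every nonzero `D`
of degree `≤ q^b` computed in product-depth `≤ ⌈log₂ q^b⌉` with `≤ q^b` wires, then `K1` holds — every `D` of
complexity and degree `≤ q^b` has such a circuit with `≤ q^{13b+25}` wires.  With `k1Wires_of_kiPlantedHitting`
(which gives the converse by dropping the depth bound) the depth ladder of `K1` is FINITE: it is decided at
product-depth `⌈log₂ q(m)^b⌉ = O(b log m)`; the open climb runs from `⌊0.72 log₂log₂log₂ m⌋`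
(`DefinabilityGapK1DepthLadder.k1AtDepth_log3_18_25_of_uniformFactorClosure`) to `O(log m)`, which is exactly lens 4's depth window in
hitting-set currency. [cite: ValiantSkyumBerkowitzRackoff1983] [cite: Burgisser2000TCS, Thm. 2.5]
[cite: KabanetsImpagliazzo2003, Thm. 7.7] -/
theorem kiPlantedHitting_of_k1Log
    (h : ∀ b m₀ : ℕ, ∃ m, m₀ ≤ m ∧
      ∀ (Γ : ArithCircuit ℂ (Fin 3 → Fin (qOf m))) (D : MvPolynomial (Fin 3 → Fin (qOf m)) ℂ),
        Γ.Computes D → Γ.productDepth ≤ Nat.clog 2 (qOf m ^ b) → Γ.edgeSize ≤ qOf m ^ b → D ≠ 0 →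
        D.totalDegree ≤ qOf m ^ b → bind₁ (kiPer m) D ≠ 0) :
    KIPlantedHitting := by
  classical
  intro b m₀
  obtain ⟨m, hm, hhit⟩ := h (13 * b + 25) m₀
  refine ⟨m, hm, fun D hD hcx hdeg => ?_⟩
  have hq2 : 2 ≤ qOf m := (qOf_spec m).2.two_le
  have hcx' : complexity D ≤ qOf m ^ b := hcx
  have hdeg' : D.totalDegree ≤ qOf m ^ b := hdeg
  obtain ⟨Γ, hΓc, hΓd, hΓe⟩ := DepthReduction.exists_computes_productDepth_le_clog D hdeg'
  have hcard : Fintype.card (Fin 3 → Fin (qOf m)) = qOf m ^ 3 := by simp [Fintype.card_fin]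
  have hΓe₁ : Γ.edgeSize ≤
      DepthReduction.vsbrEdgeBound (Fintype.card (Fin 3 → Fin (qOf m))) (qOf m ^ b) (complexity D) := hΓe
  rw [hcard] at hΓe₁
  have hpow : qOf m ^ b ≤ qOf m ^ (13 * b + 25) := Nat.pow_le_pow_right (by omega) (by omega)
  exact hhit Γ D hΓc (hΓd.trans (Nat.clog_mono_right 2 hpow))
    (hΓe₁.trans (vsbrEdgeBound_le_qOf_pow m b hcx')) hD (hdeg'.trans hpow)

/-- … and `K1 ⟹ K1log` (drop the depth bound in `k1Wires_of_kiPlantedHitting`), closing the equivalence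
`K1 ⟺ K1log`. [cite: KabanetsImpagliazzo2003, Thm. 7.7] -/
theorem k1Log_of_kiPlantedHitting (hK1 : KIPlantedHitting) :
    ∀ b m₀ : ℕ, ∃ m, m₀ ≤ m ∧
      ∀ (Γ : ArithCircuit ℂ (Fin 3 → Fin (qOf m))) (D : MvPolynomial (Fin 3 → Fin (qOf m)) ℂ),
        Γ.Computes D → Γ.productDepth ≤ Nat.clog 2 (qOf m ^ b) → Γ.edgeSize ≤ qOf m ^ b → D ≠ 0 →
        D.totalDegree ≤ qOf m ^ b → bind₁ (kiPer m) D ≠ 0 := fun b m₀ => by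
  obtain ⟨m, hm, hhit⟩ := k1Wires_of_kiPlantedHitting hK1 b m₀
  exact ⟨m, hm, fun Γ D hC _ hCe hD hdeg => hhit Γ D hC hCe hD hdeg⟩

end Summit.ValiantsHypothesis.ValiantsHypothesis.Theorems.DefinabilityGapK1DepthLadderTop

end
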